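import Summits.NavierStokesRegularity.NavierStokesRegularity.Theorems.ExtremiserTransienceKStarAttainedHalfSpaceVariation
import Literature.Analysis.FluidPDE.CurlIsometryCovariance
import Literature.Analysis.FluidPDE.IsometryInvariance
import Literature.Analysis.FluidPDE.AxisymmetricTypeIOffAxis
import Summits.NavierStokesRegularity.NavierStokesRegularity.Theorems.SoloRefuteAtarka2026Lemma34
import HarnessLib

/-!
# Crux `ExtremiserTransience.NearExtremalTransience` (stmt-NavierStokesRegularity-21883), line `extremiser_liouville`,
# stub K1b — TRANSPORT OF THE RESIDUE DATA UNDER LINEAR ISOMETRIES (`w ↦ R ∘ w ∘ R⁻¹`): the axial frame is no loss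

`--supports stmt-NavierStokesRegularity-21883` (helper).  Author: prover seat `ns-el-k1b` (g6).  The K1b residue data (g2:
real analytic, `C^∞`, divergence free, `‖Dw‖` bounded, `D¹w, D²w ∈ L²`, `‖w‖ ≡ M = ‖c‖`, `w → c`, and the three functionals
`Z = ∫‖curl w‖²`, `W = ∫|D curl w|²_F`, `S = ∫⟪curl w, Dw curl w⟫`) are invariant under conjugation by a linear isometry `R` of `ℝ³`
(`curl (R w R⁻¹) = det R · R (curl w)(R⁻¹·)`, `CurlIsometryCovariance`; `det R = ±1`).  With g5's `exists_isometry_to_axis`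
(`R c = ‖c‖e₂`) every residue object can therefore be put in the AXIAL frame `c = (0,0,M)` in which g5/g6 proved the barycentre law
and the vanishing of the blow-down vorticity (`…ConstantSpeedAxialDossier`).

* `conj_residue_regularity` : analyticity, smoothness, divergence-freeness, gradient bound, constant speed, far field transport.
* `lintegral_iteratedFDeriv_conj_eq` : `∫‖Dᵏ(R w R⁻¹)‖² = ∫‖Dᵏw‖²`.
* `Zen_conj`, `Wpa_conj`, `Jst_conj` : `Z, W, S` are invariant.

WHAT THIS IS NOT: K1b is NOT proved; nothing here proves NS regularity. [folklore]
-/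

noncomputable section

open Set Filter Topology MeasureTheory Metric Function
open scoped ENNReal NNReal Topology InnerProductSpace RealInnerProductSpace ContDiff
open Literature.Analysis.FluidPDE Literature.Analysis

namespace Summit.NavierStokesRegularity.NavierStokesRegularity.Theorems

-- the problem directory repeats the summit name (`NavierStokesRegularity/NavierStokesRegularity`)
set_option linter.dupNamespace false

namespace ExtremiserLiouville

open DepletionLadder.KStar DepletionLadder.KStar.HalfSpace

variable {w : E3 → E3} {c : E3} (R : E3 ≃ₗᵢ[ℝ] E3)

/-- `‖R ∘ A ∘ R⁻¹‖ ≤ ‖A‖` for a linear isometry `R`. [folklore] -/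
theorem opNorm_conj_linearIsometryEquiv_le (A : E3 →L[ℝ] E3) :
    ‖(R : E3 →L[ℝ] E3).comp (A.comp (R.symm : E3 →L[ℝ] E3))‖ ≤ ‖A‖ := by
  refine ContinuousLinearMap.opNorm_le_bound _ (norm_nonneg A) fun x => ?_
  show ‖R (A (R.symm x))‖ ≤ ‖A‖ * ‖x‖
  rw [R.norm_map]
  calc ‖A (R.symm x)‖ ≤ ‖A‖ * ‖R.symm x‖ := A.le_opNorm _
    _ = ‖A‖ * ‖x‖ := by rw [R.symm.norm_map]

/-- **Regularity data are transported**: for `w' = R ∘ w ∘ R⁻¹`: analytic, smooth, divergence free, the same gradient bound,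
constant speed, and `w' → R c` at infinity. [folklore] -/
theorem conj_residue_regularity (han : AnalyticOnNhd ℝ w Set.univ) (hcd : ContDiff ℝ (⊤ : ℕ∞) w)
    (hdiv : VectorCalculus.IsDivFree w) {B M : ℝ} (hB : ∀ x, ‖fderiv ℝ w x‖ ≤ B) (hM : ∀ x, ‖w x‖ = M)
    (hfar : Tendsto (fun x => w x - c) (cocompact E3) (𝓝 0)) :
    AnalyticOnNhd ℝ (fun y => R (w (R.symm y))) Set.univ ∧ ContDiff ℝ (⊤ : ℕ∞) (fun y => R (w (R.symm y))) ∧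
      VectorCalculus.IsDivFree (fun y => R (w (R.symm y))) ∧ (∀ x, ‖fderiv ℝ (fun y => R (w (R.symm y))) x‖ ≤ B) ∧
      (∀ x, ‖R (w (R.symm x))‖ = M) ∧ ‖R c‖ = ‖c‖ ∧
      Tendsto (fun y => R (w (R.symm y)) - R c) (cocompact E3) (𝓝 0) := by
  refine ⟨?_, ?_, hdiv.conj_linearIsometryEquiv R, fun x => ?_, fun x => by rw [R.norm_map, hM], R.norm_map c, ?_⟩
  · intro y _
    have hRs : AnalyticAt ℝ (fun z : E3 => (R.symm : E3 →L[ℝ] E3) z) y := (R.symm : E3 →L[ℝ] E3).analyticAt y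
    have hw : AnalyticAt ℝ w ((fun z : E3 => (R.symm : E3 →L[ℝ] E3) z) y) := han _ (mem_univ _)
    have h1 : AnalyticAt ℝ (fun z => w ((R.symm : E3 →L[ℝ] E3) z)) y := hw.comp hRs
    have hR : AnalyticAt ℝ (fun z : E3 => (R : E3 →L[ℝ] E3) z) (w ((R.symm : E3 →L[ℝ] E3) y)) := (R : E3 →L[ℝ] E3).analyticAt _
    exact AnalyticAt.comp (g := fun z : E3 => (R : E3 →L[ℝ] E3) z) (f := fun z => w ((R.symm : E3 →L[ℝ] E3) z)) (x := y)
      hR h1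
  · exact (R : E3 →L[ℝ] E3).contDiff.comp (hcd.comp (R.symm : E3 →L[ℝ] E3).contDiff)
  · rw [fderiv_conj_linearIsometryEquiv]; exact (opNorm_conj_linearIsometryEquiv_le R _).trans (hB _)
  · have h1 : Tendsto (fun y => w (R.symm y) - c) (cocompact E3) (𝓝 0) :=
      hfar.comp R.symm.toHomeomorph.map_cocompact.le
    have h2 : Tendsto (fun y => R (w (R.symm y) - c)) (cocompact E3) (𝓝 (R 0)) := (R.continuous.tendsto 0).comp h1
    rw [map_zero] at h2
    exact h2.congr fun y => by rw [map_sub]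

/-- Change of variables in an extended integral under a linear isometry of `ℝ³`. [folklore] -/
theorem lintegral_comp_linearIsometryEquiv_E3 (T : EuclideanSpace ℝ (Fin 3) ≃ₗᵢ[ℝ] EuclideanSpace ℝ (Fin 3))
    (g : EuclideanSpace ℝ (Fin 3) → ℝ≥0∞) : ∫⁻ x, g (T x) = ∫⁻ x, g x :=
  T.measurePreserving.lintegral_comp_emb T.toHomeomorph.measurableEmbedding g

/-- `∫‖Dᵏ(R w R⁻¹)‖² = ∫‖Dᵏ w‖²` (as extended integrals), `k` arbitrary. [folklore] -/
theorem lintegral_iteratedFDeriv_conj_eq (k : ℕ) :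
    (∫⁻ x, ‖iteratedFDeriv ℝ k (fun y => R (w (R.symm y))) x‖ₑ ^ 2) = ∫⁻ x, ‖iteratedFDeriv ℝ k w x‖ₑ ^ 2 := by
  have hpt : ∀ x, ‖iteratedFDeriv ℝ k (fun y => R (w (R.symm y))) x‖ = ‖iteratedFDeriv ℝ k w (R.symm x)‖ := fun x => by
    have e1 : (fun y => R (w (R.symm y))) = R ∘ (w ∘ R.symm) := rfl
    rw [e1, R.norm_iteratedFDeriv_comp_left, R.symm.norm_iteratedFDeriv_comp_right]
  have key := lintegral_comp_linearIsometryEquiv_E3 R.symm (fun z => ‖iteratedFDeriv ℝ k w z‖ₑ ^ 2)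
  rw [← key]
  refine lintegral_congr fun x => ?_
  rw [← ofReal_norm, ← ofReal_norm, hpt]

/-- **`Z` is invariant**: `∫‖curl(R w R⁻¹)‖² = ∫‖curl w‖²`. [folklore] -/
theorem Zen_conj : Zen (fun y => R (w (R.symm y))) = Zen w := by
  unfold Zen
  have e : (fun x => ‖curl (fun y => R (w (R.symm y))) x‖ ^ 2) = (fun x => ‖curl w x‖ ^ 2) ∘ R.symm := by
    funext x; simp only [Function.comp, norm_curl_conj_linearIsometryEquiv]
  rw [e]
  exact R.symm.measurePreserving.integral_comp R.symm.toHomeomorph.measurableEmbedding (fun x => ‖curl w x‖ ^ 2)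

/-- The sign `det R = ±1` squares to one and has absolute value one. [folklore] -/
theorem det_sq_eq_one : (R : E3 →L[ℝ] E3).det ^ 2 = 1 := by
  rcases det_linearIsometryEquiv_eq_one_or_eq_neg_one R with h | h
  · rw [h]; norm_num
  · rw [h]; norm_num

/-- The derivative of `curl (R w R⁻¹)`: `D curl(R w R⁻¹)(x) = det R · R ∘ D(curl w)(R⁻¹x) ∘ R⁻¹`. [folklore] -/
theorem fderiv_curl_conj (x : E3) :
    fderiv ℝ (curl (fun y => R (w (R.symm y)))) x =
      (R : E3 →L[ℝ] E3).det • (R : E3 →L[ℝ] E3).comp ((fderiv ℝ (curl w) (R.symm x)).comp (R.symm : E3 →L[ℝ] E3)) := by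
  set d : ℝ := (R : E3 →L[ℝ] E3).det with hd
  have e : curl (fun y => R (w (R.symm y))) = fun y => d • (fun z => R ((curl w) (R.symm z))) y := by
    funext y; rw [curl_conj_linearIsometryEquiv, ← hd]
  rw [e]
  by_cases hdiff : DifferentiableAt ℝ (fun z => R ((curl w) (R.symm z))) x
  · rw [fderiv_fun_const_smul hdiff, fderiv_conj_linearIsometryEquiv]
  · -- both sides are the junk value `0`
    have h1 : ¬ DifferentiableAt ℝ (curl w) (R.symm x) := by
      intro h
      apply hdiff
      have : (fun z => R ((curl w) (R.symm z))) = R ∘ (curl w) ∘ R.symm := rfl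
      rw [this]
      exact R.toContinuousLinearEquiv.differentiableAt.comp x (h.comp x R.symm.toContinuousLinearEquiv.differentiableAt)
    have hd0 : d ≠ 0 := by
      rcases det_linearIsometryEquiv_eq_one_or_eq_neg_one R with h1' | h1' <;> rw [hd, h1'] <;> norm_num
    have h2 : ¬ DifferentiableAt ℝ (fun y => d • (fun z => R ((curl w) (R.symm z))) y) x := by
      intro h
      apply hdiff
      have h' := h.const_smul d⁻¹
      have e' : (d⁻¹ • fun y => d • (fun z => R ((curl w) (R.symm z))) y) = fun z => R ((curl w) (R.symm z)) := by
        funext y; simp only [Pi.smul_apply]; rw [smul_smul, inv_mul_cancel₀ hd0, one_smul]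
      rwa [e'] at h'
    rw [fderiv_zero_of_not_differentiableAt h2, fderiv_zero_of_not_differentiableAt h1]
    simp


/-- **`W` is invariant**: `∫|D curl(R w R⁻¹)|²_F = ∫|D curl w|²_F`. [folklore] -/
theorem Wpa_conj : Wpa (fun y => R (w (R.symm y))) = Wpa w := by
  unfold Wpa
  have e : (fun x => frobeniusNormSq (fderiv ℝ (curl (fun y => R (w (R.symm y)))) x)) =
      (fun x => frobeniusNormSq (fderiv ℝ (curl w) x)) ∘ R.symm := by
    funext x
    simp only [Function.comp]
    rw [fderiv_curl_conj, Atarka2026.frobeniusNormSq_smul, det_sq_eq_one, one_mul, frobeniusNormSq_conj_linearIsometryEquiv]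
  rw [e]
  exact R.symm.measurePreserving.integral_comp R.symm.toHomeomorph.measurableEmbedding
    (fun x => frobeniusNormSq (fderiv ℝ (curl w) x))

/-- **`S` is invariant**: `∫⟪curl(R w R⁻¹), D(R w R⁻¹) curl(R w R⁻¹)⟫ = ∫⟪curl w, Dw curl w⟫` (`det R = ±1` enters squared).
[folklore] -/
theorem Jst_conj : Jst (fun y => R (w (R.symm y))) = Jst w := by
  unfold Jst
  set d : ℝ := (R : E3 →L[ℝ] E3).det with hd
  have hd2 : d * d = 1 := by have h := det_sq_eq_one R; rw [← hd, sq] at h; exact h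
  have e : (fun x => ⟪curl (fun y => R (w (R.symm y))) x,
      fderiv ℝ (fun y => R (w (R.symm y))) x (curl (fun y => R (w (R.symm y))) x)⟫_ℝ) =
      (fun x => ⟪curl w x, fderiv ℝ w x (curl w x)⟫_ℝ) ∘ R.symm := by
    funext x
    simp only [Function.comp]
    rw [curl_conj_linearIsometryEquiv, fderiv_conj_linearIsometryEquiv, ← hd]
    simp only [ContinuousLinearMap.coe_comp, Function.comp_apply, map_smul]
    rw [show ((R.symm : E3 →L[ℝ] E3) : E3 → E3) (R (curl w (R.symm x))) = R.symm (R (curl w (R.symm x))) from rfl,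
      LinearIsometryEquiv.symm_apply_apply, inner_smul_left, inner_smul_right]
    rw [show ((R : E3 →L[ℝ] E3) : E3 → E3) (fderiv ℝ w (R.symm x) (curl w (R.symm x))) =
      R (fderiv ℝ w (R.symm x) (curl w (R.symm x))) from rfl, LinearIsometryEquiv.inner_map_map]
    simp only [conj_trivial]
    rw [← mul_assoc, hd2, one_mul]
  rw [e]
  exact R.symm.measurePreserving.integral_comp R.symm.toHomeomorph.measurableEmbedding
    (fun x => ⟪curl w x, fderiv ℝ w x (curl w x)⟫_ℝ)

end ExtremiserLiouville

end Summit.NavierStokesRegularity.NavierStokesRegularity.Theorems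

end
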